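import Mathlib
import Summits.MatrixMultiplication.MatrixMultiplication.Theorems.LevelGradedCohnUmansLevelOneGL2DesignsTangencyPolarity

/-!
# The Illés–Szőnyi–Wettl bound in an ABSTRACT projective plane, and Seib's bound for polarities —
stub `stub_tangencySets` (crux `LevelOneGL2Designs`, stmt-MatrixMultiplication-14080), wall-breaker
axis 7/12 "Hermitian unital constructions", generation 1, companion to `…TangencyPolarity`

The ceiling of the stub is the unital bound: a strong representative system (flags `(pᵢ, ℓᵢ)` with
`pᵢ ∈ ℓⱼ ↔ i = j`) of a projective plane of order `n` has `N ≤ n√n + 1` flags, with equality iff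
the points form a unital (Illés–Szőnyi–Wettl 1991; Thas 1974 for semiovals).  The tree proves it in
coordinates, over fields (`UnitalBound.srs_card_sq_mul_card_le`, `…tangencySet_card_mul_pred_le`,
k7 generation 0).  The proof is pure double counting and holds in EVERY finite projective plane;
this file records it for Mathlib's abstract `Configuration.ProjectivePlane`, next to Baer's theorem
(`BaerPolarity.card_absolute_eq_of_not_isSquare`), and draws Seib's bound for polarities:

* `card_filter_mem_line_pair` — two distinct points lie on exactly one line, a point on `n + 1`;
* `srs_card_sub_one_sq_le` (**ISW, abstract form**) — for `S : Finset (P × L)` with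
  `f.1 ∈ g.2 ↔ f = g` on `S`: `(|S| − 1)² ≤ n³`.  (Line degrees `k_ℓ = #{f ∈ S : f.1 ∈ ℓ}` have
  `Σ k_ℓ = N(n+1)` and `Σ k_ℓ² = N(N+n)`; the `N` lines `f.2` have `k = 1`; Cauchy–Schwarz on the
  other `n² + n + 1 − N` lines gives `N·(n³ − (N−1)²) ≥ 0`.)
* `absolute_srs` — the absolute points of a polarity `φ` with their polars form such a system
  (an absolute line carries exactly one absolute point);
* `card_absolute_sub_one_sq_le` (**Seib 1970, in ISW form**) — hence every polarity of a plane
  of order `n` has `a` absolute points with `(a − 1)² ≤ n³`, i.e. `a ≤ n√n + 1`; with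
  `BaerPolarity.card_absolute_eq_of_not_isSquare` (`a = n + 1` for non-square `n`) this is the
  complete classical census of absolute points underlying the axis: the `q√q + 1 = r³ + 1` absolute
  points of a unitary polarity (`n = r²`) are the extremal case, unavailable in prime order.

Sources: Illés–Szőnyi–Wettl, Mitt. Math. Sem. Giessen 201 (1991) (Zbl 0741.51013) for the SRS bound;
Seib, Arch. Math. 21 (1970) for polarities; Baer [cite: Baer1946PolaritiesFiniteProjectivePlanes] for
the non-square case.  Both bounds are proved here in full (elementary).  Mathlib + `…TangencyPolarity`;
no definitions.
-/

-- `Summit.MatrixMultiplication.MatrixMultiplication.…` is the tree's mandated summit/problem namespace (D-0017).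
set_option linter.dupNamespace false

namespace Summit.MatrixMultiplication.MatrixMultiplication.Theorems.LevelOneGL2Designs.PlaneSRS

open Finset Configuration
open Summit.MatrixMultiplication.MatrixMultiplication.Theorems.LevelOneGL2Designs.BaerPolarity
  (polarity_injective)

variable {P L : Type*} [Membership P L] [Configuration.ProjectivePlane P L] [Fintype P] [Fintype L]

open scoped Classical in
/-- Through one point pass `n + 1` lines; through two distinct points, exactly one. [bookkeeping] -/
theorem card_filter_mem_line_pair (x y : P) :
    (univ.filter fun ℓ : L => x ∈ ℓ ∧ y ∈ ℓ).card =
      if x = y then ProjectivePlane.order P L + 1 else 1 := by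
  split_ifs with hxy
  · subst hxy
    have h1 : (univ.filter fun ℓ : L => x ∈ ℓ ∧ x ∈ ℓ) = univ.filter fun ℓ : L => x ∈ ℓ := by
      ext ℓ
      simp
    rw [h1, ← ProjectivePlane.lineCount_eq L x, Configuration.lineCount, Nat.card_eq_fintype_card,
      Fintype.card_subtype]
  · obtain ⟨ℓ₀, hℓ₀, huniq⟩ := HasLines.existsUnique_line P L x y hxy
    rw [Finset.card_eq_one]
    refine ⟨ℓ₀, Finset.eq_singleton_iff_unique_mem.mpr ⟨by simpa using hℓ₀, fun ℓ hℓ => ?_⟩⟩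
    exact huniq ℓ (by simpa using hℓ)

open scoped Classical in
/-- **The Illés–Szőnyi–Wettl bound in any finite projective plane.**  If `S` is a strong
representative system of a projective plane of order `n` — a finite set of flags with
`f.1 ∈ g.2 ↔ f = g` for all `f, g ∈ S` — then `(|S| − 1)² ≤ n³`, i.e. `|S| ≤ n√n + 1`.
[double counting + Cauchy–Schwarz; Illés–Szőnyi–Wettl 1991, Thas 1974] -/
theorem srs_card_sub_one_sq_le (S : Finset (P × L))
    (hS : ∀ f ∈ S, ∀ g ∈ S, (f.1 ∈ g.2 ↔ f = g)) :
    (S.card - 1) ^ 2 ≤ ProjectivePlane.order P L ^ 3 := by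
  set n : ℕ := ProjectivePlane.order P L with hn_def
  set N : ℕ := S.card with hN_def
  have hLcard : Fintype.card L = n ^ 2 + n + 1 := ProjectivePlane.card_lines P L
  -- distinct flags have distinct points and distinct lines
  have hpt : ∀ f ∈ S, ∀ g ∈ S, f.1 = g.1 → f = g := by
    intro f hf g hg h
    exact (hS f hf g hg).mp (h ▸ (hS g hg g hg).mpr rfl)
  have hln : ∀ f ∈ S, ∀ g ∈ S, f.2 = g.2 → f = g := by
    intro f hf g hg h
    exact ((hS g hg f hf).mp (h ▸ (hS g hg g hg).mpr rfl)).symm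
  -- line degrees
  set k : L → ℕ := fun ℓ => (S.filter fun f => f.1 ∈ ℓ).card with hk_def
  have hk : ∀ ℓ, k ℓ = ∑ f ∈ S, if f.1 ∈ ℓ then 1 else 0 := fun ℓ => Finset.card_filter _ _
  -- (1) first moment
  have h1 : ∑ ℓ, k ℓ = N * (n + 1) := by
    simp_rw [hk]
    rw [Finset.sum_comm]
    have h : ∀ f ∈ S, (∑ ℓ : L, if f.1 ∈ ℓ then 1 else 0) = n + 1 := by
      intro f _
      rw [← Finset.card_filter, ← ProjectivePlane.lineCount_eq L f.1, Configuration.lineCount,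
        Nat.card_eq_fintype_card, Fintype.card_subtype]
    rw [Finset.sum_congr rfl h, Finset.sum_const, smul_eq_mul]
  -- (2) second moment
  have h2 : ∑ ℓ, k ℓ ^ 2 = N * (N + n) := by
    have hsq : ∀ ℓ, k ℓ ^ 2 = ∑ f ∈ S, ∑ g ∈ S, if f.1 ∈ ℓ ∧ g.1 ∈ ℓ then 1 else 0 := by
      intro ℓ
      rw [sq, hk, Finset.sum_mul_sum]
      refine Finset.sum_congr rfl fun f _ => Finset.sum_congr rfl fun g _ => ?_
      rw [ite_zero_mul_ite_zero, mul_one]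
    simp_rw [hsq]
    rw [Finset.sum_comm]
    have h : ∀ f ∈ S, (∑ ℓ : L, ∑ g ∈ S, if f.1 ∈ ℓ ∧ g.1 ∈ ℓ then 1 else 0) = N + n := by
      intro f hf
      rw [Finset.sum_comm]
      have hg : ∀ g ∈ S, (∑ ℓ : L, if f.1 ∈ ℓ ∧ g.1 ∈ ℓ then 1 else 0) =
          1 + (if f = g then n else 0) := by
        intro g hg
        rw [← Finset.card_filter, card_filter_mem_line_pair]
        by_cases hfg : f = g
        · subst hfg
          rw [if_pos rfl, if_pos rfl]
          ring
        · have : f.1 ≠ g.1 := fun h => hfg (hpt f hf g hg h)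
          rw [if_neg this, if_neg hfg]
      rw [Finset.sum_congr rfl hg, Finset.sum_add_distrib, Finset.sum_const, smul_eq_mul, mul_one,
        Finset.sum_ite_eq]
      rw [if_pos hf]
    rw [Finset.sum_congr rfl h, Finset.sum_const, smul_eq_mul]
  -- (3) the `N` tangent lines have degree one
  set Λ : Finset L := S.image Prod.snd with hΛ_def
  have hΛcard : Λ.card = N := by
    rw [hΛ_def, Finset.card_image_of_injOn]
    intro f hf g hg h
    exact hln f hf g hg h
  have hkΛ : ∀ ℓ ∈ Λ, k ℓ = 1 := by
    intro ℓ hℓ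
    obtain ⟨f, hf, rfl⟩ := Finset.mem_image.mp hℓ
    change (S.filter fun g => g.1 ∈ f.2).card = 1
    rw [Finset.card_eq_one]
    refine ⟨f, Finset.eq_singleton_iff_unique_mem.mpr ⟨?_, fun g hg => ?_⟩⟩
    · exact Finset.mem_filter.mpr ⟨hf, (hS f hf f hf).mpr rfl⟩
    · obtain ⟨hg, hgf⟩ := Finset.mem_filter.mp hg
      exact (hS g hg f hf).mp hgf
  -- (4) moments over the other lines
  set L' : Finset L := univ \ Λ with hL'_def
  have hsplit : ∀ g : L → ℕ, ∑ ℓ ∈ L', g ℓ + ∑ ℓ ∈ Λ, g ℓ = ∑ ℓ, g ℓ := fun g =>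
    Finset.sum_sdiff (Finset.subset_univ Λ)
  have hΛ1 : ∑ ℓ ∈ Λ, k ℓ = N := by
    rw [Finset.sum_congr rfl hkΛ, Finset.sum_const, smul_eq_mul, mul_one, hΛcard]
  have hΛ2 : ∑ ℓ ∈ Λ, k ℓ ^ 2 = N := by
    rw [Finset.sum_congr rfl fun ℓ hℓ => by rw [hkΛ ℓ hℓ], Finset.sum_const, smul_eq_mul, one_pow,
      mul_one, hΛcard]
  have ha : ∑ ℓ ∈ L', k ℓ + N = N * (n + 1) := by rw [← h1, ← hsplit k, hΛ1]
  have hb : ∑ ℓ ∈ L', k ℓ ^ 2 + N = N * (N + n) := by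
    rw [← h2, ← hsplit (fun ℓ => k ℓ ^ 2), hΛ2]
  have hc : L'.card + N = n ^ 2 + n + 1 := by
    rw [hL'_def, Finset.card_sdiff_of_subset (Finset.subset_univ Λ), Finset.card_univ, hLcard, hΛcard,
      Nat.sub_add_cancel]
    rw [← hLcard, ← hΛcard]
    exact Finset.card_le_univ Λ
  -- (5) Cauchy–Schwarz on the other lines
  have hcs : (∑ ℓ ∈ L', k ℓ) ^ 2 ≤ L'.card * ∑ ℓ ∈ L', k ℓ ^ 2 := sq_sum_le_card_mul_sum_sq
  -- (6) algebra
  rcases Nat.eq_zero_or_pos N with hN0 | hNpos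
  · rw [hN0]
    simp
  have hid : (N : ℤ) * ((n : ℤ) ^ 3 - ((N : ℤ) - 1) ^ 2) =
      (L'.card : ℤ) * (∑ ℓ ∈ L', k ℓ ^ 2 : ℕ) - ((∑ ℓ ∈ L', k ℓ : ℕ) : ℤ) ^ 2 := by
    have ha' : ((∑ ℓ ∈ L', k ℓ : ℕ) : ℤ) = N * (n + 1) - N := by
      have h := congrArg (Nat.cast : ℕ → ℤ) ha
      push_cast at h ⊢
      linear_combination h
    have hb' : ((∑ ℓ ∈ L', k ℓ ^ 2 : ℕ) : ℤ) = N * (N + n) - N := by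
      have h := congrArg (Nat.cast : ℕ → ℤ) hb
      push_cast at h ⊢
      linear_combination h
    have hc' : (L'.card : ℤ) = n ^ 2 + n + 1 - N := by
      have h := congrArg (Nat.cast : ℕ → ℤ) hc
      push_cast at h
      linear_combination h
    rw [ha', hb', hc']
    ring
  have hnonneg : (0 : ℤ) ≤ (N : ℤ) * ((n : ℤ) ^ 3 - ((N : ℤ) - 1) ^ 2) := by
    rw [hid, sub_nonneg]
    exact_mod_cast hcs
  have hkey : ((N : ℤ) - 1) ^ 2 ≤ (n : ℤ) ^ 3 := by
    by_contra hlt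
    push Not at hlt
    have : (N : ℤ) * ((n : ℤ) ^ 3 - ((N : ℤ) - 1) ^ 2) < 0 :=
      mul_neg_of_pos_of_neg (by exact_mod_cast hNpos) (by linarith)
    linarith
  have hcast : (((N - 1 : ℕ) : ℤ)) = (N : ℤ) - 1 := by push_cast [Nat.cast_sub hNpos]; ring
  have : ((N - 1 : ℕ) : ℤ) ^ 2 ≤ (n : ℤ) ^ 3 := by rw [hcast]; exact hkey
  exact_mod_cast this

open scoped Classical in
/-- **Absolute points with their polars form a strong representative system.**  For a polarity
`φ` (`p ∈ φ q ↔ q ∈ φ p`), the flags `(p, φ p)` over the absolute points `p ∈ φ p` satisfy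
`p ∈ φ q ↔ p = q`: an absolute line carries exactly one absolute point. [elementary] -/
theorem absolute_srs (φ : P → L) (hφ : ∀ p q, p ∈ φ q ↔ q ∈ φ p) :
    ∀ f ∈ (univ.filter fun p : P => p ∈ φ p).image fun p => (p, φ p),
      ∀ g ∈ (univ.filter fun p : P => p ∈ φ p).image fun p => (p, φ p), (f.1 ∈ g.2 ↔ f = g) := by
  intro f hf g hg
  simp only [Finset.mem_image, Finset.mem_filter, Finset.mem_univ, true_and] at hf hg
  obtain ⟨p, hp, rfl⟩ := hf
  obtain ⟨q, hq, rfl⟩ := hg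
  constructor
  · intro hpq
    change p ∈ φ q at hpq
    have hqp : q ∈ φ p := (hφ q p).mpr hpq
    by_cases h : p = q
    · subst h
      rfl
    · -- both `φ p` and `φ q` contain `p` and `q`
      rcases Nondegenerate.eq_or_eq hp hqp hpq hq with h' | h'
      · exact (h h').elim
      · exact (h (polarity_injective φ hφ h')).elim
  · intro h
    rw [Prod.mk.injEq] at h
    obtain ⟨rfl, -⟩ := h
    exact hp

/-- **Seib's bound (1970), ISW form.**  A polarity of a finite projective plane of order `n` has
`a` absolute points with `(a − 1)² ≤ n³`, i.e. `a ≤ n√n + 1` — attained by the unitary polarities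
of square-order planes (the unital), while for non-square `n` Baer's theorem gives `a = n + 1`
(`BaerPolarity.card_absolute_eq_of_not_isSquare`). [Seib 1970; here from `srs_card_sub_one_sq_le`
and `absolute_srs`] -/
theorem card_absolute_sub_one_sq_le (φ : P → L) (hφ : ∀ p q, p ∈ φ q ↔ q ∈ φ p) :
    (Nat.card {p // p ∈ φ p} - 1) ^ 2 ≤ ProjectivePlane.order P L ^ 3 := by
  classical
  have hinj : Set.InjOn (fun p : P => (p, φ p)) ↑(univ.filter fun p : P => p ∈ φ p) :=
    fun p _ q _ h => (Prod.mk.inj h).1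
  have hcard : ((univ.filter fun p : P => p ∈ φ p).image fun p => (p, φ p)).card =
      Nat.card {p // p ∈ φ p} := by
    rw [Finset.card_image_of_injOn hinj, Nat.card_eq_fintype_card, Fintype.card_subtype]
  rw [← hcard]
  exact srs_card_sub_one_sq_le _ (absolute_srs φ hφ)

end Summit.MatrixMultiplication.MatrixMultiplication.Theorems.LevelOneGL2Designs.PlaneSRS
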